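import Summits.QuantumFields.YangMills.Theorems.BalabanLadderNTMirrorHankelConvex
import Summits.QuantumFields.YangMills.Theorems.BalabanLadderNTMarkovMirrorFloor
import HarnessLib

/-!
# Crux `NT` (stmt-QuantumFields-19353): the mirror-Hankel layer in the route's letters (`torusE`, `cfgReflect`,
# `latticeConnectedCorr`)

Helper file (`--supports stmt-QuantumFields-19353`) of the fleet lead prover of crux `NT` (unit `ym-spine-19353-p1`,
g10), hypothesis-free; last of the series `…NTMirrorHankelShift` / `…NTMirrorHankel` / `…NTMirrorHankelConvex`.
Those files work on the torus `GaugeConfig 4 (2L+1) G` with `DependsOn`-slabs; the consumers of clause (i) — the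
seam's (MF) floor `X ≤ Cov_T(Ṽ_v∘Θ₀, Ṽ_v)` (`MarkovMirror*`, `ConjugateResponse*`), `LowerBounds` through
`MarkovMirrorChiral.Q2 = Cov_T(Wᴿ∘Θ₀, Ṽ)`, and the IR leg's `GapInUnits` — speak of CYLINDER observables
`W : LGConfig 4 G → ℝ` of `ℤ⁴` read through the periodic lift, the `ℤ⁴` time reflection `Θ₀ = cfgReflect`, the
translations `configShift`, and `torusE` / `latticeConnectedCorr`.  The dictionary and the transcription:

* `timeShift_torusLift` — the torus translate of a lifted observable is the lift of the `ℤ⁴`-translate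
  (`τ_{n e₀} W = W ∘ configShift (−n e₀)`); `dependsOn_slab_of_window` — a cylinder whose links are based at times in
  `[0, T−1]` lifts to an observable of the slab `0 ≤ t ≤ T` of every torus of side `2L+1 ≥ T+1`;
* **`mirrorSeq_torusLift`** — the mirror sequence of the lift IS the route's connected correlator:
  `q_{W∘lift}(n) = latticeConnectedCorr r.ρ β (2L+1) (W∘Θ₀) W n = Cov_T(W∘Θ₀, τ_{n e₀} W)`, and
  `latticeConnectedCorr_eq_torusCov` writes the same in `torusE` letters;
* `torusMirrorCov_pair` — `Cov_T((τ_s W)∘Θ₀, τ_t W) = Cov_T(W∘Θ₀, τ_{s+t} W)`: in particular the (MF) form of an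
  observable carried at times `≥ s` is the entry `2s` of the mirror sequence of the same observable moved down to the
  mirror (`torusMirrorCov_self_eq`);
* **`latticeConnectedCorr_mirror_nonneg`**, **`latticeConnectedCorr_mirror_logConvex`** — for every compact `G`, every
  lattice representation `r`, every `β ≥ 0`, every odd torus `2L+1 ≥ 3`, every bounded measurable cylinder `W` with
  links based at times in `[0, T−1]`: `n ↦ Cov_T(W∘Θ₀, τ_{n e₀} W)` is `≥ 0` for `2T + n ≤ 2L` and log-convex,
  `C(n+1)² ≤ C(n) C(n+2)`, for `2T + n + 2 ≤ 2L`;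
* **`latticeConnectedCorr_mirrorFloor_propagates`** — a floor `X ≤ Cov_T(W∘Θ₀, τ_u W)` at ONE lag `u` forces
  `X ^ U ≤ (K²)^{U−u} · Cov_T(W∘Θ₀, τ_U W) ^ u` at every lag `U ≥ u` with `2T + U ≤ 2L` (`|W| ≤ K`);
* **`mul_mul_le_log_of_mirrorFloor_of_clustering`** — if moreover `Cov_T(W∘Θ₀, τ_U W) ≤ C e^{−μ U}` (the shape of
  `GapInUnits`' clustering bound for the pair `(W∘Θ₀, W)` at rate `μ = c₁ a(β)`), then
  `μ · u · U ≤ U · log(K²/X) + u · log(C/K²)`.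

Located reading for the crux (owner's / LEAD's pen; nothing registered): with `W = Ṽ_v` moved to the mirror, `u = 2δ/a(β)`
(`δ` = physical distance of `supp v` from the reflection plane), `K ≍ ‖v‖₁ a(β)⁻⁴`, a β-UNIFORM (MF)/clause-(i) floor
`X` and the IR leg's clustering at physical mass `m = μ/a(β)` can coexist on large tori only if
`2δ·m ≤ 8 log(1/a(β)) + log(C_v/X) + o(1)` — the two-point floor currency pins the correlation length from below only
logarithmically in the unit (the «finer units die by clustering» half of NT's two-sided pin, as a theorem schema).

Refs: K. Osterwalder, E. Seiler, Ann. Phys. 110 (1978) 440, §2; J. Glimm, A. Jaffe, *Quantum Physics* (1987) §6.1;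
sibling in species letters: `FiniteSusceptibilityWeakCoupling.MirrorLogConvex` (p-landed for stmt-QuantumFields-9442;
reflected copy in the shifted slot, gauge-invariant species), whose `mirrorCorr_fold` relates the two conventions.
-/

set_option autoImplicit false

noncomputable section

open MeasureTheory Finset
open Literature.MathematicalPhysics.QuantumFieldTheory Literature.MathematicalPhysics.QuantumLattice
open Literature.Probability.LatticeModels
open Literature.MathematicalPhysics.QuantumFieldTheory.WilsonRP
open Literature.MathematicalPhysics.QuantumFieldTheory.WilsonNegRP
open Summit.QuantumFields.YangMills.Cruxes.OSLegsFromFemtoAndGap.DlrCollarTransfer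
open Summit.QuantumFields.YangMills.Cruxes.NT.MarkovMirror (dependsOn_comp_torusLift)

namespace Summit.QuantumFields.YangMills.Cruxes.NT.MirrorHankel

variable (G : Type) [Group G] [TopologicalSpace G] [IsTopologicalGroup G] [CompactSpace G]
  [MeasurableSpace G] [BorelSpace G] (r : LatticeRep G)

/-! ## §1 Dictionary: lifts, translates, windows -/

omit [TopologicalSpace G] [IsTopologicalGroup G] [CompactSpace G] [BorelSpace G] [Group G] in
/-- **The torus translate of a lifted observable is the lift of the `ℤ⁴`-translate**:
`timeShift n (W ∘ lift) U = W (configShift (−n e₀) (lift U))` (every side). [folklore] -/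
theorem timeShift_torusLift {α : Type*} (L' : ℕ) [NeZero L'] (W : LGConfig 4 G → α) (n : ℕ)
    (U : GaugeConfig 4 L' G) :
    timeShift n (fun V : GaugeConfig 4 L' G => W (torusLift L' V)) U =
      W (configShift (-(Pi.single 0 (n : ℤ))) (torusLift L' U)) := by
  have h := congrFun (toTorusObservable_comp_configShift (G := G) L' (-(Pi.single 0 (n : ℤ))) W) U
  simp only [toTorusObservable, Function.comp_apply] at h
  have hproj : Torus.proj L' (-(Pi.single (0 : Fin 4) (n : ℤ))) = -(shiftVec (d := 4) (L := L') n) := by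
    funext k
    by_cases hk : k = 0
    · subst hk; simp [shiftVec]
    · simp [shiftVec, hk]
  rw [hproj] at h
  rw [h]
  rfl

omit [TopologicalSpace G] [IsTopologicalGroup G] [CompactSpace G] [BorelSpace G] [Group G] [MeasurableSpace G] in
/-- A link of `ℤ⁴` based at a time `t ∈ [0, T − 1]` projects, on the torus of side `2L+1` with `T ≤ 2L`, to a link of
the slab `0 ≤ t ≤ T`. [folklore] -/
theorem torusEdge_mem_slab (L T : ℕ) (hT : T ≤ 2 * L) {e : Literature.MathematicalPhysics.QuantumLattice.ZdEdge 4} (h0 : 0 ≤ e.1 0) (h1 : e.1 0 + 1 ≤ T) :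
    torusEdge (2 * L + 1) e ∈ slab (d := 4) (L := 2 * L + 1) 0 T := by
  obtain ⟨x, i⟩ := e
  simp only at h0 h1
  obtain ⟨t, ht⟩ := Int.eq_ofNat_of_zero_le h0
  have htT : t + 1 ≤ T := by omega
  have hlt : t < 2 * L + 1 := by omega
  have hlt' : t + 1 < 2 * L + 1 := by omega
  have hval : ((Torus.proj (2 * L + 1) x) 0).val = t := by
    simp only [Torus.proj_apply, ht, Int.cast_natCast, ZMod.val_natCast, Nat.mod_eq_of_lt hlt]
  refine ⟨Nat.zero_le _, by simp only [torusEdge]; rw [hval]; omega, ?_⟩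
  simp only [torusEdge]
  by_cases hi : i = 0
  · subst hi
    rw [WilsonRP.shift_apply_self]
    have : ((Torus.proj (2 * L + 1) x) 0 + 1 : ZMod (2 * L + 1)) = ((t + 1 : ℕ) : ZMod (2 * L + 1)) := by
      rw [← ZMod.natCast_zmod_val ((Torus.proj (2 * L + 1) x) 0), hval]; push_cast; ring
    rw [this, ZMod.val_natCast, Nat.mod_eq_of_lt hlt']
    exact htT
  · rw [WilsonRP.shift_apply_of_ne _ (fun h => hi h.symm), hval]
    omega

omit [TopologicalSpace G] [IsTopologicalGroup G] [CompactSpace G] [BorelSpace G] [Group G] [MeasurableSpace G] in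
/-- **A window cylinder lifts to a slab observable**: if `W` reads only links based at times in `[0, T − 1]`, then on
every torus of side `2L+1` with `T ≤ 2L` the lift `W ∘ torusLift` is an observable of the slab `0 ≤ t ≤ T`. [folklore] -/
theorem dependsOn_slab_of_window (L T : ℕ) (hT : T ≤ 2 * L) {α : Type*} {W : LGConfig 4 G → α}
    {SW : Finset (Literature.MathematicalPhysics.QuantumLattice.ZdEdge 4)} (hW : IsCylinder W SW) (hw : ∀ e ∈ SW, 0 ≤ e.1 0 ∧ e.1 0 + 1 ≤ T) :
    DependsOn (fun U : GaugeConfig 4 (2 * L + 1) G => W (torusLift (2 * L + 1) U)) (slab (d := 4) (L := 2 * L + 1) 0 T) := by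
  classical
  refine (dependsOn_comp_torusLift (2 * L + 1) hW).mono fun e he => ?_
  obtain ⟨e', he', rfl⟩ := Finset.mem_image.1 (Finset.mem_coe.1 he)
  exact torusEdge_mem_slab L T hT (hw e' he').1 (hw e' he').2

/-! ## §2 The mirror sequence of a lift is the route's connected correlator -/

/-- **`q_{W∘lift}(n) = latticeConnectedCorr (W∘Θ₀) W n`**: the mirror sequence of a lifted observable on the torus of
side `2L+1` is the route's connected time-correlation of the pair `(W∘Θ₀, W)` at lag `n` (`Θ₀ = cfgReflect`;
`lift ∘ ϑ = Θ₀ ∘ lift`, `torusLift_negReflect`; `ϑ`-invariance of Wilson's torus measure). [cite: OsterwalderSeiler1978, §2] -/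
theorem mirrorSeq_torusLift (β : ℝ) (L : ℕ) (W : LGConfig 4 G → ℝ) (n : ℕ) :
    mirrorSeq r.ρ β (fun U : GaugeConfig 4 (2 * L + 1) G => W (torusLift (2 * L + 1) U)) n =
      latticeConnectedCorr r.ρ β (2 * L + 1) (fun V => W (cfgReflect V)) W n := by
  have hrefl : ∀ U : GaugeConfig 4 (2 * L + 1) G,
      W (torusLift (2 * L + 1) U.negReflect) = W (cfgReflect (torusLift (2 * L + 1) U)) := fun U => by
    rw [torusLift_negReflect]
  have hmean : ∫ U, W (torusLift (2 * L + 1) U) ∂(wilsonMeasure (d := 4) (L := 2 * L + 1) r.ρ β) =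
      ∫ U, W (cfgReflect (torusLift (2 * L + 1) U)) ∂(wilsonMeasure (d := 4) (L := 2 * L + 1) r.ρ β) := by
    rw [← Reflection.integral_comp_negReflect_odd r.ρ (S := L) rfl r.continuous β
      (fun U : GaugeConfig 4 (2 * L + 1) G => W (torusLift (2 * L + 1) U))]
    simp only [hrefl]
  unfold mirrorSeq latticeConnectedCorr
  rw [integral_timeShift]
  simp only [hrefl, timeShift_torusLift]
  rw [← hmean]

/-- The route's connected correlator of the mirror pair in `torusE` letters:
`latticeConnectedCorr (W∘Θ₀) W n = E_T[(W∘Θ₀) · τ_{n e₀}W] − E_T[W∘Θ₀] · E_T[W]` (the tree's definition takes the second mean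
unshifted; by translation invariance it equals `E_T[τ_{n e₀}W]`). [folklore] -/
theorem latticeConnectedCorr_eq_torusCov (β : ℝ) (L : ℕ) (W : LGConfig 4 G → ℝ) (n : ℕ) :
    latticeConnectedCorr r.ρ β (2 * L + 1) (fun V => W (cfgReflect V)) W n =
      torusE G r β L (fun V => W (cfgReflect V) * W (configShift (-(Pi.single 0 (n : ℤ))) V)) -
        torusE G r β L (fun V => W (cfgReflect V)) * torusE G r β L W := by
  unfold latticeConnectedCorr torusE
  rfl

/-- **Hankel form of the mirror covariance in the route's letters**: for any observable `W` and shifts `s, t`,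
`Cov_T((τ_{s e₀}W)∘Θ₀, τ_{t e₀}W) = Cov_T(W∘Θ₀, τ_{(s+t) e₀}W)` (lag-`0` correlator of the translates on the left,
lag `s+t` on the right). [cite: OsterwalderSeiler1978, §2] -/
theorem torusMirrorCov_pair (β : ℝ) (L : ℕ) (W : LGConfig 4 G → ℝ) (s t : ℕ) :
    latticeConnectedCorr r.ρ β (2 * L + 1)
        (fun V => W (configShift (-(Pi.single 0 (s : ℤ))) (cfgReflect V)))
        (fun V => W (configShift (-(Pi.single 0 (t : ℤ))) V)) 0 =
      latticeConnectedCorr r.ρ β (2 * L + 1) (fun V => W (cfgReflect V)) W (s + t) := by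
  rw [← mirrorSeq_torusLift, ← cov_timeShift_negReflect_timeShift r.ρ β
    (fun U : GaugeConfig 4 (2 * L + 1) G => W (torusLift (2 * L + 1) U)) s t]
  have hrefl : ∀ U : GaugeConfig 4 (2 * L + 1) G,
      torusLift (2 * L + 1) U.negReflect = cfgReflect (torusLift (2 * L + 1) U) := fun U => torusLift_negReflect U
  have h0 : ∀ V : LGConfig 4 G, configShift (0 : Literature.Probability.LatticeModels.Site 4) V = V := fun V => by
    funext e; simp [Literature.MathematicalPhysics.QuantumLattice.configShift_apply]
  -- the mean of the reflected translate equals the mean of the translate (`ϑ`-invariance)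
  have hmeanϑ : ∫ U, timeShift s (fun V : GaugeConfig 4 (2 * L + 1) G => W (torusLift (2 * L + 1) V)) U.negReflect
        ∂(wilsonMeasure (d := 4) (L := 2 * L + 1) r.ρ β) =
      ∫ U, timeShift s (fun V : GaugeConfig 4 (2 * L + 1) G => W (torusLift (2 * L + 1) V)) U
        ∂(wilsonMeasure (d := 4) (L := 2 * L + 1) r.ρ β) :=
    Reflection.integral_comp_negReflect_odd r.ρ (S := L) rfl r.continuous β _
  rw [← hmeanϑ]
  unfold latticeConnectedCorr
  simp only [timeShift_torusLift, hrefl, Nat.cast_zero, Pi.single_zero, neg_zero, h0]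

/-- **The (MF) form of a translate**: `Cov_T((τ_{s e₀}W)∘Θ₀, τ_{s e₀}W) = Cov_T(W∘Θ₀, τ_{2s e₀}W)` in `torusE` letters — the
mirror covariance of an observable carried `s` units above the mirror is the entry `2s` of the mirror sequence of the same
observable moved down to the mirror. [cite: OsterwalderSeiler1978, §2] -/
theorem torusMirrorCov_self_eq (β : ℝ) (L : ℕ) (W : LGConfig 4 G → ℝ) (s : ℕ) :
    torusE G r β L (fun V => W (configShift (-(Pi.single 0 (s : ℤ))) (cfgReflect V)) *
        W (configShift (-(Pi.single 0 (s : ℤ))) V)) -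
      torusE G r β L (fun V => W (configShift (-(Pi.single 0 (s : ℤ))) (cfgReflect V))) *
        torusE G r β L (fun V => W (configShift (-(Pi.single 0 (s : ℤ))) V)) =
      latticeConnectedCorr r.ρ β (2 * L + 1) (fun V => W (cfgReflect V)) W (2 * s) := by
  rw [show 2 * s = s + s by ring, ← torusMirrorCov_pair G r β L W s s]
  have h0 : ∀ V : LGConfig 4 G, configShift (0 : Literature.Probability.LatticeModels.Site 4) V = V := fun V => by
    funext e; simp [Literature.MathematicalPhysics.QuantumLattice.configShift_apply]
  unfold latticeConnectedCorr torusE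
  simp only [Nat.cast_zero, Pi.single_zero, neg_zero, h0]

/-! ## §3 Positivity, log-convexity, floor propagation and the clustering cap — in the route's letters -/

section RouteLetters

variable {G} {r}
variable {W : LGConfig 4 G → ℝ} {SW : Finset (Literature.MathematicalPhysics.QuantumLattice.ZdEdge 4)} {T : ℕ}

omit [Group G] [TopologicalSpace G] [IsTopologicalGroup G] [CompactSpace G] [BorelSpace G] in
/-- Hypotheses of the torus layer for a lifted window cylinder (measurable, bounded, slab). [folklore] -/
theorem lift_hyps (hWm : Measurable W) {K : ℝ} (hK : ∀ V, |W V| ≤ K) (hWS : IsCylinder W SW)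
    (hw : ∀ e ∈ SW, 0 ≤ e.1 0 ∧ e.1 0 + 1 ≤ T) {L : ℕ} (hT : T ≤ 2 * L) :
    Measurable (fun U : GaugeConfig 4 (2 * L + 1) G => W (torusLift (2 * L + 1) U)) ∧
      (∃ K' : ℝ, ∀ U : GaugeConfig 4 (2 * L + 1) G, |W (torusLift (2 * L + 1) U)| ≤ K') ∧
      DependsOn (fun U : GaugeConfig 4 (2 * L + 1) G => W (torusLift (2 * L + 1) U))
        (slab (d := 4) (L := 2 * L + 1) 0 T) :=
  ⟨hWm.comp (measurable_torusLift (2 * L + 1)), ⟨K, fun _ => hK _⟩, dependsOn_slab_of_window G L T hT hWS hw⟩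

/-- **The mirror correlator of a window cylinder is non-negative** (every compact `G`, every lattice representation
`r`, `β ≥ 0`, odd torus `2L+1 ≥ 3`): for a bounded measurable cylinder `W` with links based at times in `[0, T−1]`,
`0 ≤ Cov_T(W∘Θ₀, τ_{n e₀}W)` for `2T + n ≤ 2L`. [cite: OsterwalderSeiler1978, §2] -/
theorem latticeConnectedCorr_mirror_nonneg {β : ℝ} (hβ : 0 ≤ β) {L : ℕ} (hL : 1 ≤ L) (hWm : Measurable W)
    {K : ℝ} (hK : ∀ V, |W V| ≤ K) (hWS : IsCylinder W SW) (hw : ∀ e ∈ SW, 0 ≤ e.1 0 ∧ e.1 0 + 1 ≤ T) {n : ℕ}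
    (hn : 2 * T + n ≤ 2 * L) :
    0 ≤ latticeConnectedCorr r.ρ β (2 * L + 1) (fun V => W (cfgReflect V)) W n := by
  obtain ⟨hm, hb, hdep⟩ := lift_hyps hWm hK hWS hw (L := L) (by omega)
  rw [← mirrorSeq_torusLift]
  exact mirrorSeq_nonneg r.ρ (S := L) rfl hL r.continuous hβ hm hb hdep hn

/-- **The mirror correlator of a window cylinder is log-convex in the lag**:
`Cov_T(W∘Θ₀, τ_{n+1}W)² ≤ Cov_T(W∘Θ₀, τ_n W) · Cov_T(W∘Θ₀, τ_{n+2}W)` for `2T + n + 2 ≤ 2L`.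
[cite: FrohlichIsraelLiebSimon1978, Thm. 2.1] -/
theorem latticeConnectedCorr_mirror_logConvex {β : ℝ} (hβ : 0 ≤ β) {L : ℕ} (hL : 1 ≤ L) (hWm : Measurable W)
    {K : ℝ} (hK : ∀ V, |W V| ≤ K) (hWS : IsCylinder W SW) (hw : ∀ e ∈ SW, 0 ≤ e.1 0 ∧ e.1 0 + 1 ≤ T) {n : ℕ}
    (hn : 2 * T + n + 2 ≤ 2 * L) :
    latticeConnectedCorr r.ρ β (2 * L + 1) (fun V => W (cfgReflect V)) W (n + 1) ^ 2 ≤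
      latticeConnectedCorr r.ρ β (2 * L + 1) (fun V => W (cfgReflect V)) W n *
        latticeConnectedCorr r.ρ β (2 * L + 1) (fun V => W (cfgReflect V)) W (n + 2) := by
  obtain ⟨hm, hb, hdep⟩ := lift_hyps hWm hK hWS hw (L := L) (by omega)
  simp only [← mirrorSeq_torusLift]
  exact mirrorSeq_logConvex r.ρ (S := L) rfl hL r.continuous hβ hm hb hdep hn

/-- **A mirror floor propagates outward (route letters).**  If `X ≤ Cov_T(W∘Θ₀, τ_{u e₀}W)` (`0 ≤ X`) at one lag
`u ≤ U` with `2T + U ≤ 2L`, and `|W| ≤ K`, then `X ^ U ≤ (K²)^(U−u) · Cov_T(W∘Θ₀, τ_{U e₀}W) ^ u`.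
[cite: GlimmJaffe1987, §6.1] -/
theorem latticeConnectedCorr_mirrorFloor_propagates {β : ℝ} (hβ : 0 ≤ β) {L : ℕ} (hL : 1 ≤ L)
    (hWm : Measurable W) {K : ℝ} (hK : ∀ V, |W V| ≤ K) (hWS : IsCylinder W SW)
    (hw : ∀ e ∈ SW, 0 ≤ e.1 0 ∧ e.1 0 + 1 ≤ T) {u U : ℕ} (hu : u ≤ U) (hU : 2 * T + U ≤ 2 * L) {X : ℝ}
    (hX : 0 ≤ X) (hfloor : X ≤ latticeConnectedCorr r.ρ β (2 * L + 1) (fun V => W (cfgReflect V)) W u) :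
    X ^ U ≤ (K ^ 2) ^ (U - u) * latticeConnectedCorr r.ρ β (2 * L + 1) (fun V => W (cfgReflect V)) W U ^ u := by
  obtain ⟨hm, -, hdep⟩ := lift_hyps hWm hK hWS hw (L := L) (by omega)
  rw [← mirrorSeq_torusLift] at hfloor ⊢
  exact mirrorSeq_floor_propagates r.ρ (S := L) rfl hL r.continuous hβ hm (fun U => hK _) hdep hu hU hX hfloor

/-- **A mirror floor caps any clustering rate (route letters).**  If `0 < X ≤ Cov_T(W∘Θ₀, τ_{u e₀}W)` at one lag
`u ≤ U` (`2T + U ≤ 2L`, `|W| ≤ K`, `0 < K`) and the same correlator CLUSTERS at lag `U`,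
`Cov_T(W∘Θ₀, τ_{U e₀}W) ≤ C · exp(−μ U)` (`C > 0`; the shape of `GapInUnits` for the pair `(W∘Θ₀, W)`), then
`μ · u · U ≤ U · log(K²/X) + u · log(C/K²)`. [cite: GlimmJaffe1987, §6.1] -/
theorem mul_mul_le_log_of_mirrorFloor_of_clustering {β : ℝ} (hβ : 0 ≤ β) {L : ℕ} (hL : 1 ≤ L)
    (hWm : Measurable W) {K : ℝ} (hKpos : 0 < K) (hK : ∀ V, |W V| ≤ K) (hWS : IsCylinder W SW)
    (hw : ∀ e ∈ SW, 0 ≤ e.1 0 ∧ e.1 0 + 1 ≤ T) {u U : ℕ} (hu : u ≤ U) (hU : 2 * T + U ≤ 2 * L) {X C μ : ℝ}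
    (hX : 0 < X) (hfloor : X ≤ latticeConnectedCorr r.ρ β (2 * L + 1) (fun V => W (cfgReflect V)) W u)
    (hC : 0 < C) (hdecay : latticeConnectedCorr r.ρ β (2 * L + 1) (fun V => W (cfgReflect V)) W U ≤
      C * Real.exp (-(μ * U))) :
    μ * u * U ≤ U * Real.log (K ^ 2 / X) + u * Real.log (C / K ^ 2) := by
  obtain ⟨hm, -, hdep⟩ := lift_hyps hWm hK hWS hw (L := L) (by omega)
  rw [← mirrorSeq_torusLift] at hfloor hdecay
  exact mul_mul_le_log_of_mirrorFloor_of_decay r.ρ (S := L) rfl hL r.continuous hβ hm hKpos (fun U => hK _) hdep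
    hu hU hX hfloor hC hdecay

end RouteLetters

end Summit.QuantumFields.YangMills.Cruxes.NT.MirrorHankel

end
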